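import Summits.BirchSwinnertonDyer.BirchSwinnertonDyer.Theorems.ResidualThetaTransportAtTwoResidualSignedLambdaLowerCMAtTwoStationRValues
import Summits.BirchSwinnertonDyer.BirchSwinnertonDyer.Theorems.ResidualThetaTransportAtTwoResidualSignedLambdaLowerCMAtTwoStationRRoadSocket
import Summits.BirchSwinnertonDyer.BirchSwinnertonDyer.Theorems.ResidualThetaTransportAtTwoResidualSignedLambdaLowerCMAtTwoRelayDescends
import Literature.NumberTheory.EllipticCurves.GreenbergSelmerCharIdealPrincipalProofs
import HarnessLib

/-!
# Station (R) of line `onepair` — THE REGISTERED STUB `stub_kzgValueRelation` (crux RSL_g, stmt-BirchSwinnertonDyer-22608, skeleton v3f)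

Route `ResidualThetaTransportAtTwo` (RTT), crux `ResidualSignedLambdaLowerCMAtTwo` (stmt-BirchSwinnertonDyer-22608), line `onepair` v3f (skeleton
b54462f6d406cd17), KZ_g interior station (R). Seat `bsd-wall-tp2-p2x-w3` g18 (width seat). ONE THEOREM whose type is the registered stub text VERBATIM
(`--supports stmt-BirchSwinnertonDyer-22608`); THEOREMS ONLY, no `sorry`. It closes the STUB, not the crux: RSL_g stays OPEN until the LEAD's composition
discharges the remaining stubs (the PRINT children `stub_kzgPrints`, (E) `stub_kzgTrivialisation`, LVsq, S4₀, glue); BSD is not proved by any of this.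

PROOF (memo `STATION-R-PORT-w3g18.md`, evidence #54 on 22608; files R1–R4 + the evaluation road A/B): unpack child A's `KatoValuedClass` into
`q ≠ 0`, `μ̃ ≠ 0`, (ND), (BKρ), (VALρ); `StationR.values_identity` gives `δ ≠ 0`, the torsor unit `U` and, for all `m ≥ 1` and primitive `ζ ∈ μ_{2^{2m}}`,
`(3qδ)·(𝔯̃_e μ̃)(ζ−1)·θ^ι_{2m}(ζ−1) = −((−1)^m ω⁻_{2m})(ζ−1)·(U·e(𝒸 z))(ζ−1)`; `𝔯̃_e ≠ 0` (`rtilde_ne_zero`: otherwise `𝒸 z = 0` by RIG, and the same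
identity for the sheared trivialisation `e ∘ D` — admissible because `𝒸((C y)•z) = 0` — makes `𝔯̃_{e∘D}·μ̃·L⁻` vanish through the socket at `E := 0`,
absurd); then the scaled socket `StationR.Road.hERL_of_scaledColumnValues_fixedMultiplier` over `S′ = range ι ∪ {q}` with multiplier `𝔯̃_e·μ̃`, constant
`u = 2^a·3·q·δ ∈ 𝒪_{S′}`, `ν = 2^a`, `w = U` gives `C ν · e(𝒸 z) = (𝔯̃_e μ̃)·(L⁻·v)`, `v ≠ 0`, i.e. the stub with `u := 𝔯̃_e·v ≠ 0`.

References: [Kato2004Asterisque] Thm. 12.5 (1) (pp. 221–222), §15.16 (p. 265); [Kobayashi2003] Thm. 6.2, (8.23), Prop. 8.25–8.26; [Pollack2003] Prop. 6.18;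
[Lang2002] Ch. VI §4 Thm. 4.1.
-/

set_option autoImplicit false
-- D-0017: single-problem summit, so `Summit.BirchSwinnertonDyer.BirchSwinnertonDyer.…` repeats a namespace BY DESIGN.
set_option linter.dupNamespace false
set_option backward.isDefEq.respectTransparency false

noncomputable section

open scoped Classical NumberField Polynomial

open Polynomial (X C)
open NumberField IsDedekindDomain WeierstrassCurve Field Literature.NumberTheory.EllipticCurves
  Literature.NumberTheory.EllipticCurves.ModularForms
  Literature.NumberTheory.GaloisRepresentations Literature.NumberTheory.EllipticCurves.GreenbergSelmer
  Literature.NumberTheory.EllipticCurves.Rank1Residual Literature.NumberTheory.EllipticCurves.Kobayashi2003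
  Literature.NumberTheory.EllipticCurves.FormalGroupChart Literature.NumberTheory.EllipticCurves.ZpExtension
  Literature.NumberTheory.EllipticCurves.Sprung2012
  Summit.BirchSwinnertonDyer.Rank1Residual.Additive Summit.BirchSwinnertonDyer.Rank1Residual.Additive.PadicCyclotomicTower
  Summit.BirchSwinnertonDyer.BirchSwinnertonDyer.Theorems.ThetaTransport
  Rat.HeightOneSpectrum

namespace Summit.BirchSwinnertonDyer.BirchSwinnertonDyer.Theorems.OnePair

/-! ## §1 `𝔯̃_e ≠ 0` -/

section Rtilde

variable {M : ℕ} [NeZero M] (g : CuspForm (CongruenceSubgroup.Gamma0 M) 2) (ι : coeffField g →+* PadicAlgCl 2) (Ω : ℂ)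
  {W : WeierstrassCurve ℚ} [W.IsElliptic] [W.IsGloballyMinimal] {κ : ZpExtension ℚ 2} {γ : absoluteGaloisGroup ℚ}
  {S₀ : Finset (HeightOneSpectrum (𝓞 ℚ))} {n : ℕ} {ρ : FramedGaloisRep ℚ ↥(padicCoeffIntegers (Set.range ι)) 2}
  {Θ : ∀ v : HeightOneSpectrum (𝓞 ℚ), ((2 : ℕ) : 𝓞 ℚ) ∈ v.asIdeal → (Cofree ρ ↥(padicCoeffField (Set.range ι)) ≃+ (Fin n → ↥(W.geomPrimaryTorsion 2)))}
  {hΘ : ∀ v hv (δ : absoluteGaloisGroup (v.adicCompletion ℚ)) m i,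
    Θ v hv (resGalOfEmb (closureEmb (K := ℚ) (v.adicCompletion ℚ)) δ • m) i = resGalOfEmb (closureEmb (K := ℚ) (v.adicCompletion ℚ)) δ • Θ v hv m i}
  {I : Kato2004.IwasawaH1DataCoeff (FramedGaloisRep.toGaloisRep ρ) 2 κ γ}
  {Sg : AddSubgroup (subgroupH1 κ.kerSubgroup (Cofree ρ ↥(padicCoeffField (Set.range ι))))} [Module ↥(padicCoeffIntegers (Set.range ι)) ↥Sg]

set_option maxHeartbeats 6400000 in
/-- **`𝔯̃_e := Σ_i C(c′_i)·e(δ_i) ≠ 0`** for an admissible trivialisation `e` of a valued class (needs the Pollack pair: `μ̃·L⁻ ≠ 0`). If `𝔯̃_e = 0`, the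
values identity kills `U·e(𝒸 z)` at every primitive `ζ` of even order, so `𝒸 z = 0` (RIG) and `𝒸((C y)•z) = 0` ((E)-clause); then the SHEARED
trivialisation `e ∘ D` (`D` negates coordinate `i₁`, `c′_{i₁} ≠ 0`) is admissible, has `𝔯̃_{e∘D} = −2·C(c′_{i₁})·e(δ_{i₁}) ≠ 0`, and its values identity
reads `(𝔯̃_{e∘D} μ̃)(ζ−1)·θ^ι_{2m}(ζ−1) = 0`; the scaled socket at `E := 0` then gives `𝔯̃_{e∘D}·μ̃·L⁻·v = 0` with all factors non-zero — absurd.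
[cite: Kato2004Asterisque, Thm. 12.5 (1) (pp. 221–222)] [cite: Pollack2003, Prop. 6.18] -/
theorem rtilde_ne_zero [FiniteDimensional ℚ_[2] (padicCoeffField (Set.range ι))]
    (hss : GoodSS W 2) (ha : W.frobeniusTrace 2 = 0) (hκ : κ.IsCyclotomic) (hγ : κ.IsTopGenerator γ) (hcv : IsCyclotomicVariable 2 γ)
    {Lp Lm : IwasawaAlgebraO (Set.range ι)} (hL : IsPollackPairK g ι Ω Lp Lm)
    (π : OnePairPins (Set.range ι) W κ γ S₀ n ρ Θ hΘ I Sg) (F : π.KatoFrame) (z : I.H)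
    (c' : Fin n → ↥(padicCoeffIntegers (Set.range ι))) (w : ℕ → Fin π.nb → PadicAlgCl 2) (q : PadicAlgCl 2) (μt : IwasawaAlgebraO (Set.range ι))
    (hq : q ≠ 0) (hμ : μt ≠ 0) (hND : π.CoordNondeg c') (hBK : π.KatoBKCoord F.Φ F.τ z c' w) (hVAL : π.KatoValCoord g ι Ω F.τ w q μt)
    (e : (Fin n → PowerSeries ℤ_[2]) ≃+ IwasawaAlgebraO (Set.range ι))
    (he : ∀ (r : PowerSeries ℤ_[2]) (t : Fin n → PowerSeries ℤ_[2]), e (r • t) = PowerSeries.map (padicIntToCoeffIntegers (Set.range ι)) r * e t)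
    (hlin : ∀ y : ↥(padicCoeffIntegers (Set.range ι)), e (π.cvec ((PowerSeries.C y : IwasawaAlgebraO (Set.range ι)) • z)) = PowerSeries.C y * e (π.cvec z)) :
    (∑ i : Fin n, PowerSeries.C (c' i) * e (Pi.single i 1)) ≠ 0 := by
  intro hrt
  -- notation
  set φ : ↥(padicCoeffIntegers (Set.range ι)) →+* ℂ_[2] := (algebraMap (PadicAlgCl 2) ℂ_[2]).comp (padicCoeffIntegers (Set.range ι)).subtype with hφdef
  -- (a) the values identity for `e`: the column values vanish, hence `𝒸 z = 0`
  obtain ⟨δ, U, hδ0, hEV⟩ := StationR.values_identity g ι Ω hss ha hκ hγ hcv π F z c' w q μt hND hBK hVAL e he hlin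
  have hUE : PowerSeries.map (padicIntToCoeffIntegers (Set.range ι)) (U : PowerSeries ℤ_[2]) * e (π.cvec z) = 0 := by
    refine StationR.Road.eq_zero_of_forall_primitive_tsum_eq_zero (Set.range ι) (fun i => 2 * (i + 1) - 1) (fun m => ⟨m, by omega⟩) ?_
    intro i ζ hζ
    have h2 : 2 * (i + 1) - 1 + 1 = 2 * (i + 1) := by omega
    rw [h2] at hζ
    have h := hEV (i + 1) (by omega) ζ hζ
    simp only [hrt, zero_mul, map_zero, tsum_zero, mul_zero] at h
    -- `h : 0 = -(ω⁻ value) * (column value)`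
    have hω : ((-1 : ℤ[X]) ^ (i + 1) * cyclotomicOmegaMinus 2 (2 * (i + 1))).eval₂ (Int.castRingHom ℂ_[2]) (ζ - 1) ≠ 0 := by
      rw [Polynomial.eval₂_mul, Polynomial.eval₂_pow, Polynomial.eval₂_neg, Polynomial.eval₂_one]
      refine mul_ne_zero (pow_ne_zero _ (neg_ne_zero.mpr one_ne_zero)) ?_
      have := eval₂_cyclotomicOmegaMinus_ne_zero (p := 2) ⟨i + 1, two_mul (i + 1)⟩ hζ
      rwa [show (algebraMap ℤ ℂ_[2]) = Int.castRingHom ℂ_[2] from RingHom.ext_int _ _] at this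
    have h' := h.symm
    rw [mul_eq_zero] at h'
    rcases h' with h' | h'
    · exact absurd (neg_eq_zero.mp h') hω
    · exact h'
  have hcz : π.cvec z = 0 := by
    have h1 : e (π.cvec z) = 0 := by
      have hu : IsUnit (PowerSeries.map (padicIntToCoeffIntegers (Set.range ι)) (U : PowerSeries ℤ_[2])) := (U.map (PowerSeries.map _).toMonoidHom).isUnit
      exact (hu.mul_right_eq_zero).mp hUE
    exact e.injective (by rw [h1, map_zero])
  have hcy : ∀ y : ↥(padicCoeffIntegers (Set.range ι)), π.cvec ((PowerSeries.C y : IwasawaAlgebraO (Set.range ι)) • z) = 0 := by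
    intro y
    apply e.injective
    rw [hlin y, hcz, map_zero, mul_zero]
  -- (b) an index with `c′_{i₁} ≠ 0`
  obtain ⟨i₁, hi₁⟩ : ∃ i₁ : Fin n, c' i₁ ≠ 0 := by
    by_contra hall
    push Not at hall
    have h01 : (fun (a : ↥(padicCoeffIntegers (Set.range ι))) (i : Fin n) => π.t₀ (c' i * a)) 0 =
        (fun (a : ↥(padicCoeffIntegers (Set.range ι))) (i : Fin n) => π.t₀ (c' i * a)) 1 := by
      funext i; simp [hall i]
    exact zero_ne_one (hND h01)
  -- (c) the sheared trivialisation `e ∘ D`, `D` = negation of coordinate `i₁`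
  set D : (Fin n → PowerSeries ℤ_[2]) ≃+ (Fin n → PowerSeries ℤ_[2]) :=
    AddEquiv.piCongrRight fun i => if i = i₁ then AddEquiv.neg (PowerSeries ℤ_[2]) else AddEquiv.refl _ with hDdef
  have hD : ∀ (t : Fin n → PowerSeries ℤ_[2]) (i : Fin n), D t i = if i = i₁ then -t i else t i := by
    intro t i
    simp only [hDdef, AddEquiv.piCongrRight_apply]
    split_ifs <;> simp
  set e' : (Fin n → PowerSeries ℤ_[2]) ≃+ IwasawaAlgebraO (Set.range ι) := D.trans e with he'def
  have he'ap : ∀ t, e' t = e (D t) := fun t => rfl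
  have he' : ∀ (r : PowerSeries ℤ_[2]) (t : Fin n → PowerSeries ℤ_[2]), e' (r • t) = PowerSeries.map (padicIntToCoeffIntegers (Set.range ι)) r * e' t := by
    intro r t
    have hDr : D (r • t) = r • D t := by
      funext i; rw [hD, Pi.smul_apply, Pi.smul_apply, hD]; split_ifs <;> simp [smul_eq_mul, mul_neg]
    rw [he'ap, he'ap, hDr, he]
  have hlin'' : ∀ y : ↥(padicCoeffIntegers (Set.range ι)), e' (π.cvec ((PowerSeries.C y : IwasawaAlgebraO (Set.range ι)) • z)) = PowerSeries.C y * e' (π.cvec z) := by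
    intro y; rw [hcy, hcz, map_zero, mul_zero]
  -- `𝔯̃_{e'} = -2 C(c′_{i₁}) e(δ_{i₁}) ≠ 0`
  have hsingle : ∀ i : Fin n, D (Pi.single i 1) = (if i = i₁ then (-1 : PowerSeries ℤ_[2]) else 1) • Pi.single i 1 := by
    intro i; funext j
    rw [hD, Pi.smul_apply, smul_eq_mul]
    by_cases hj : j = i
    · subst hj; simp
    · simp [Pi.single_eq_of_ne hj]
  have hrt' : (∑ i : Fin n, PowerSeries.C (c' i) * e' (Pi.single i 1)) =
      -(2 : IwasawaAlgebraO (Set.range ι)) * (PowerSeries.C (c' i₁) * e (Pi.single i₁ 1)) := by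
    have hterm : ∀ i : Fin n, PowerSeries.C (c' i) * e' (Pi.single i 1) =
        PowerSeries.C (c' i) * e (Pi.single i 1) + (if i = i₁ then -(2 : IwasawaAlgebraO (Set.range ι)) * (PowerSeries.C (c' i) * e (Pi.single i 1)) else 0) := by
      intro i
      rw [he'ap, hsingle, he]
      split_ifs
      · rw [map_neg, map_one]; ring
      · rw [map_one]; ring
    rw [Finset.sum_congr rfl fun i _ => hterm i, Finset.sum_add_distrib, hrt, zero_add, Finset.sum_ite_eq' Finset.univ i₁]
    simp
  have hrt'ne : (∑ i : Fin n, PowerSeries.C (c' i) * e' (Pi.single i 1)) ≠ 0 := by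
    rw [hrt']
    refine mul_ne_zero (neg_ne_zero.mpr ?_) (mul_ne_zero ?_ ?_)
    · intro h2
      have h2' := congrArg (fun F : IwasawaAlgebraO (Set.range ι) => ((PowerSeries.constantCoeff F : ↥(padicCoeffIntegers (Set.range ι))) : PadicAlgCl 2)) h2
      simp only [map_ofNat, map_zero] at h2'
      norm_num at h2'
    · intro h0
      apply hi₁
      have := congrArg (PowerSeries.coeff 0) h0
      simpa using this
    · intro h0
      have h1 : (Pi.single i₁ (1 : PowerSeries ℤ_[2]) : Fin n → PowerSeries ℤ_[2]) = 0 := e.injective (by rw [h0, map_zero])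
      have h2 := congrFun h1 i₁
      simp at h2
  -- (d) the values identity for `e'`: `(𝔯̃_{e'} μ̃)(ζ−1)·θ(ζ−1) = 0`
  obtain ⟨δ', U', hδ'0, hEV'⟩ := StationR.values_identity g ι Ω hss ha hκ hγ hcv π F z c' w q μt hND hBK hVAL e' he' hlin''
  have hzero : ∀ m : ℕ, 1 ≤ m → ∀ ζ : ℂ_[2], IsPrimitiveRoot ζ (2 ^ (2 * m)) →
      (∑' k, φ (PowerSeries.coeff k ((∑ i : Fin n, PowerSeries.C (c' i) * e' (Pi.single i 1)) * μt)) * (ζ - 1) ^ k) *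
        ((mazurTateElementK g Ω 2 (2 * m)).map ι).eval₂ (algebraMap (PadicAlgCl 2) ℂ_[2]) (ζ - 1) = 0 := by
    intro m hm ζ hζ
    have h := hEV' m hm ζ hζ
    rw [he'ap (π.cvec z), hcz, map_zero, map_zero, mul_zero] at h
    simp only [map_zero, zero_mul, tsum_zero, mul_zero] at h
    have hc : algebraMap (PadicAlgCl 2) ℂ_[2] (3 * q * (δ' : PadicAlgCl 2)) ≠ 0 := by
      rw [map_ne_zero_iff _ (algebraMap (PadicAlgCl 2) ℂ_[2]).injective]
      refine mul_ne_zero (mul_ne_zero three_ne_zero hq) ?_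
      exact_mod_cast hδ'0
    rw [mul_assoc] at h
    exact (mul_eq_zero.mp h).resolve_left hc
  -- (e) the socket at `E := 0`
  have hsock := StationR.Road.hERL_of_scaledColumnValues_fixedMultiplier (S' := Set.range ι) le_rfl hL 0
    ((∑ i : Fin n, PowerSeries.C (c' i) * e' (Pi.single i 1)) * μt) (mul_ne_zero hrt'ne hμ) 1 one_ne_zero
    ⟨1, 1, one_ne_zero, isUnit_one, 1, fun m hm ζ hζ => by
      rw [map_one, one_mul, hzero m hm ζ hζ]
      simp only [mul_zero, map_zero, zero_mul, tsum_zero]⟩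
  obtain ⟨ν, v, hν, hv, hrel⟩ := hsock
  rw [mul_zero] at hrel
  exact mul_ne_zero (mul_ne_zero hrt'ne hμ) (mul_ne_zero hL.2.1 hv) hrel.symm

end Rtilde

/-! ## §2 The stub -/

set_option maxHeartbeats 3200000 in
/-- **Station (R) `stub_kzgValueRelation` — the REGISTERED STUB TEXT of line `onepair` v3f, PROVED** (see the module docstring for the proof). Closes
the stub (by name + signature) for the LEAD's composition `stub_katoZetaCMAtTwo`; it does NOT close RSL_g / KZ_g, whose remaining stubs are the PRINT
children and (E); BSD is not proved by this. [cite: Kato2004Asterisque, Thm. 12.5 (1) (pp. 221–222), §15.16 (p. 265)]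
[cite: Kobayashi2003, Thm. 6.2, (8.23) (p. 18), Prop. 8.25–8.26] [cite: Pollack2003, Prop. 6.18] [cite: Lang2002, Ch. VI §4 Thm. 4.1] -/
theorem stub_kzgValueRelation :
    open Literature.NumberTheory.EllipticCurves GreenbergSelmer GreenbergVatsal2000 Kobayashi2003 ModularForms Rank1Residual Literature.NumberTheory.GaloisRepresentations Literature.NumberTheory.Automorphic IsDedekindDomain NumberField Field Rat.HeightOneSpectrum PowerSeries Summit.BirchSwinnertonDyer.BirchSwinnertonDyer.Theorems.OnePair in ∀ (W : WeierstrassCurve ℚ) [W.IsElliptic] [W.IsGloballyMinimal], ¬ W.HasCM → W.analyticRank = 0 → GoodSS W 2 → W.frobeniusTrace 2 = 0 → W.Δ < 0 → ∀ (M : ℕ) [NeZero M] (g : CuspForm (CongruenceSubgroup.Gamma0 M) 2) (ι : coeffField g →+* PadicAlgCl 2) (Ω : ℂ), Odd M → IsNewform0 g → IsCMForm (liftToGamma1 M 2 g) → cuspCoeff g 2 = 0 → IsCohomologicalPlusPeriod g ι Ω → (∀ ℓ : ℕ, ℓ.Prime → ¬ ℓ ∣ 2 * M * W.conductorNorm ℤ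 → ‖embCoeff g ι ℓ - (W.frobeniusTrace ℓ : PadicAlgCl 2)‖ < 1) → ∀ (κ : ZpExtension ℚ 2) (γ : absoluteGaloisGroup ℚ), κ.IsCyclotomic → κ.IsTopGenerator γ → IsCyclotomicVariable 2 γ → ∀ (S₀ : Finset (HeightOneSpectrum (RingOfIntegers ℚ))), (∀ v ∈ S₀, ((2 : ℕ) : RingOfIntegers ℚ) ∉ v.asIdeal) → (∀ v, ¬ W.HasGoodReductionAt v → v ∈ S₀) → (∀ v, natGenerator v ∣ M → v ∈ S₀) → ∀ (Lp Lm : IwasawaAlgebraO (Set.range ι)) (d : ℕ), IsPollackPairK g ι Ω Lp Lm → (∀ k, ‖coeff k (iwasawaOToPowerSeries (Set.range ι) Lm)‖ ≤ ‖coeff d (iwasawaOToPowerSeries (Set.range ι) Lm)‖) → (∀ k < d, ‖coeff k (iwasawaOToPowerSeries (Set.range ι) Lm)‖ < ‖coeff d (iwasawaOToPowerSeries (Set.range ι) Lm)‖) → ∀ (n : ℕ) (ρ : FramedGaloisRep ℚ (coeffO (Set.range ι)) 2) (Θ : ∀ v : HeightOneSpectrum (RingOfIntegers ℚ), ((2 :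 ℕ) : RingOfIntegers ℚ) ∈ v.asIdeal → (CofreeF (Set.range ι) ρ ≃+ (Fin n → ↥(W.geomPrimaryTorsion 2)))), (∀ v, ¬ natGenerator v ∣ 2 * M → ρ.IsUnramifiedAt v ∧ ∃ P : Polynomial (coeffO (Set.range ι)), P.map (padicCoeffIntegers (Set.range ι)).subtype = Polynomial.X ^ 2 - Polynomial.C (embCoeff g ι (natGenerator v)) * Polynomial.X + Polynomial.C ((natGenerator v : ℕ) : PadicAlgCl 2) ∧ ρ.HasFrobCharpolyAt v P) → ∀ (hΘ : ∀ v hv (δ : absoluteGaloisGroup (v.adicCompletion ℚ)) m i, Θ v hv (resGalOfEmb (closureEmb (K := ℚ) (v.adicCompletion ℚ)) δ • m) i = resGalOfEmb (closureEmb (K := ℚ) (v.adicCompletion ℚ)) δ • Θ v hv m i), ∀ (ϖ : (coeffO (Set.range ι))), Irreducible ϖ → ∀ (Sg : AddSubgroup (H1Γ (Set.range ι) κ ρ)) [Module (coeffO (Set.range ι)) ↥Sg], (∀ (a : (coeffO (Set.range ι))) (s : ↥Sg), ((a • s : ↥Sg) : H1Γ (Set.range ι) κ ρ) = scalarH1 κ.kerSubgroup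 (CofreeF (Set.range ι) ρ) a s) → (∀ y : H1Γ (Set.range ι) κ ρ, y ∈ Sg ↔ y ∈ plusSelmerSet (Set.range ι) W κ S₀ n ρ Θ) → (∀ (τ : absoluteGaloisGroup ℚ) (y : H1Γ (Set.range ι) κ ρ), y ∈ Sg → conjH1 κ.kerSubgroup (CofreeF (Set.range ι) ρ) τ y ∈ Sg) → (plusSelmerTorsionSet (Set.range ι) W κ S₀ n ρ Θ ϖ).Finite → ∀ (I : Kato2004.IwasawaH1DataCoeff (FramedGaloisRep.toGaloisRep ρ) 2 κ γ) [Module (coeffO (Set.range ι)) I.H] [IsScalarTower (coeffO (Set.range ι)) (IwasawaAlgebraO (Set.range ι)) I.H], (∀ (a : (coeffO (Set.range ι))) (x : I.H), a • x = (PowerSeries.C a : IwasawaAlgebraO (Set.range ι)) • x) → ∀ (π : OnePairPins (Set.range ι) W κ γ S₀ n ρ Θ hΘ I Sg), ∀ (F : π.KatoFrame) (z : I.H) (c' : Fin n → coeffO (Set.range ι)) (w : ℕ → Fin π.nb → PadicAlgCl 2) (q : PadicAlgCl 2) (μt : IwasawaAlgebraO (Set.range ι)), π.KatoValuedClass g ι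 Ω F.Φ F.τ z c' w q μt → ∀ (e : (Fin n → PowerSeries ℤ_[2]) ≃+ IwasawaAlgebraO (Set.range ι)), (∀ (r : PowerSeries ℤ_[2]) (t : Fin n → PowerSeries ℤ_[2]), e (r • t) = PowerSeries.map (padicIntToCoeffIntegers (Set.range ι)) r * e t) → (∀ (s : IwasawaAlgebraO (Set.range ι)) (x : I.H), x ∈ Submodule.span (IwasawaAlgebraO (Set.range ι)) ({z} : Set I.H) → e (π.cvec (s • x)) = s * e (π.cvec x)) → ∃ (ν : coeffO (Set.range ι)) (u : IwasawaAlgebraO (Set.range ι)), ν ≠ 0 ∧ u ≠ 0 ∧ PowerSeries.C ν * e (π.cvec z) = μt * (Lm * u) := by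
  intro W _ _ hcm hr hss ha hΔ M _ g ι Ω hM hg hcmg ha2 hΩ hcong κ γ hκ hγ hcv S₀ hS₀2 hS₀bad hS₀M Lp Lm dd hPP hlam1 hlam2 n ρ Θ hfrob hΘ ϖ hϖ
    Sg _ hSg1 hSg2 hSg3 hfin I _ _ hIC π F z c' w q μt hA e he hlin
  obtain ⟨hq0, hμ0, hND, hBK, hVAL, -⟩ := hA
  haveI : FiniteDimensional ℚ (ModularForms.coeffField g) := ModularForms.IsNewform0.finiteDimensional_coeffField_holds hg
  haveI : FiniteDimensional ℚ_[2] ↥(padicCoeffField (Set.range ι)) := GreenbergSelmer.finiteDimensional_padicCoeffField ι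
  have hlin' : ∀ y : ↥(padicCoeffIntegers (Set.range ι)),
      e (π.cvec ((PowerSeries.C y : IwasawaAlgebraO (Set.range ι)) • z)) = PowerSeries.C y * e (π.cvec z) :=
    fun y => hlin (PowerSeries.C y) z (Submodule.mem_span_singleton_self z)
  -- the values identity and `𝔯̃_e ≠ 0`
  obtain ⟨δ, U, hδ0, hEV⟩ := StationR.values_identity g ι Ω hss ha hκ hγ hcv π F z c' w q μt hND hBK hVAL e he hlin'
  have hrt := rtilde_ne_zero g ι Ω hss ha hκ hγ hcv hPP π F z c' w q μt hq0 hμ0 hND hBK hVAL e he hlin'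
  set rt : IwasawaAlgebraO (Set.range ι) := ∑ i : Fin n, PowerSeries.C (c' i) * e (Pi.single i 1) with hrtdef
  -- the enlarged coefficient ring `𝒪_{S′}`, `S′ = range ι ∪ {q}`, and the integral constant `u = 2^a · 3 q δ`
  haveI : FiniteDimensional ℚ_[2] ↥(padicCoeffField (Set.range ι ∪ {q})) := finiteDimensional_padicCoeffField_range_union_singleton ι q
  have hO : padicCoeffIntegers (Set.range ι) ≤ padicCoeffIntegers (Set.range ι ∪ {q}) :=
    MazurTateValuesRelay.padicCoeffIntegers_mono Set.subset_union_left
  have hmem : 3 * q * (δ : PadicAlgCl 2) ∈ padicCoeffField (Set.range ι ∪ {q}) := by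
    refine mul_mem (mul_mem ?_ (MazurTateValuesRelay.mem_padicCoeffField_union_singleton _ q)) ?_
    · exact_mod_cast (natCast_mem (padicCoeffField (Set.range ι ∪ {q})) 3)
    · exact IntermediateField.adjoin.mono ℚ_[2] _ _ Set.subset_union_left δ.2
  obtain ⟨a, ha⟩ := MazurTateValuesRelay.exists_natCast_pow_mul_mem_padicCoeffIntegers hmem
  have hu : (⟨_, ha⟩ : ↥(padicCoeffIntegers (Set.range ι ∪ {q}))) ≠ 0 := by
    intro h0
    have h1 : (2 : PadicAlgCl 2) ^ a * (3 * q * (δ : PadicAlgCl 2)) = 0 := by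
      have := congrArg (fun x : ↥(padicCoeffIntegers (Set.range ι ∪ {q})) => (x : PadicAlgCl 2)) h0
      simpa using this
    have hδ' : (δ : PadicAlgCl 2) ≠ 0 := by exact_mod_cast hδ0
    exact mul_ne_zero (pow_ne_zero _ two_ne_zero) (mul_ne_zero (mul_ne_zero three_ne_zero hq0) hδ') h1
  -- the socket
  have hν0 : ((2 : ↥(padicCoeffIntegers (Set.range ι))) ^ a) ≠ 0 := by
    intro h0
    have h1 := congrArg (fun x : ↥(padicCoeffIntegers (Set.range ι)) => (x : PadicAlgCl 2)) h0
    have h22 : (((2 : ↥(padicCoeffIntegers (Set.range ι)))) : PadicAlgCl 2) = 2 := rfl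
    simp only [SubmonoidClass.coe_pow, ZeroMemClass.coe_zero, h22] at h1
    exact pow_ne_zero _ two_ne_zero h1
  have hEVC : ∃ (ν : ↥(padicCoeffIntegers (Set.range ι))) (w' : IwasawaAlgebraO (Set.range ι)), ν ≠ 0 ∧ IsUnit w' ∧
      ∃ m₀ : ℕ, ∀ m : ℕ, m₀ ≤ m → ∀ ζ : ℂ_[2], IsPrimitiveRoot ζ (2 ^ (2 * m)) →
        ((algebraMap (PadicAlgCl 2) ℂ_[2]).comp (padicCoeffIntegers (Set.range ι ∪ {q})).subtype) ⟨_, ha⟩ *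
          (∑' k, ((algebraMap (PadicAlgCl 2) ℂ_[2]).comp (padicCoeffIntegers (Set.range ι)).subtype)
            (PowerSeries.coeff k (rt * μt)) * (ζ - 1) ^ k) *
          ((mazurTateElementK g Ω 2 (2 * m)).map ι).eval₂ (algebraMap (PadicAlgCl 2) ℂ_[2]) (ζ - 1) =
        -(((-1 : ℤ[X]) ^ m * cyclotomicOmegaMinus 2 (2 * m)).eval₂ (Int.castRingHom ℂ_[2]) (ζ - 1)) *
          ∑' k, ((algebraMap (PadicAlgCl 2) ℂ_[2]).comp (padicCoeffIntegers (Set.range ι)).subtype)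
            (PowerSeries.coeff k (PowerSeries.C ν * w' * e (π.cvec z))) * (ζ - 1) ^ k := by
    refine ⟨(2 : ↥(padicCoeffIntegers (Set.range ι))) ^ a, PowerSeries.map (padicIntToCoeffIntegers (Set.range ι)) (U : PowerSeries ℤ_[2]),
      hν0, (U.map (PowerSeries.map (padicIntToCoeffIntegers (Set.range ι))).toMonoidHom).isUnit, 1, fun m hm ζ hζ => ?_⟩
    have h := hEV m hm ζ hζ
    have h2a : ((algebraMap (PadicAlgCl 2) ℂ_[2]).comp (padicCoeffIntegers (Set.range ι ∪ {q})).subtype) ⟨_, ha⟩ =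
        (2 : ℂ_[2]) ^ a * algebraMap (PadicAlgCl 2) ℂ_[2] (3 * q * (δ : PadicAlgCl 2)) := by
      show algebraMap (PadicAlgCl 2) ℂ_[2] ((2 : PadicAlgCl 2) ^ a * (3 * q * (δ : PadicAlgCl 2))) = _
      rw [map_mul, map_pow, map_ofNat]
    have hC : PowerSeries.C ((2 : ↥(padicCoeffIntegers (Set.range ι))) ^ a) *
        PowerSeries.map (padicIntToCoeffIntegers (Set.range ι)) (U : PowerSeries ℤ_[2]) * e (π.cvec z) =
        PowerSeries.C ((2 : ↥(padicCoeffIntegers (Set.range ι))) ^ a) *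
          (PowerSeries.map (padicIntToCoeffIntegers (Set.range ι)) (U : PowerSeries ℤ_[2]) * e (π.cvec z)) := by ring
    have h2 : algebraMap (PadicAlgCl 2) ℂ_[2] ((((2 : ↥(padicCoeffIntegers (Set.range ι))) ^ a : ↥(padicCoeffIntegers (Set.range ι))) :
        PadicAlgCl 2)) = (2 : ℂ_[2]) ^ a := by
      have h22 : (((2 : ↥(padicCoeffIntegers (Set.range ι)))) : PadicAlgCl 2) = 2 := rfl
      rw [SubmonoidClass.coe_pow, map_pow, h22, map_ofNat]
    rw [h2a, hC, StationR.tsum_C_mul_eval, h2]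
    linear_combination (2 : ℂ_[2]) ^ a * h
  obtain ⟨ν, v, hν, hv, hrel⟩ := StationR.Road.hERL_of_scaledColumnValues_fixedMultiplier hO hPP (e (π.cvec z)) (rt * μt)
    (mul_ne_zero hrt hμ0) ⟨_, ha⟩ hu hEVC
  refine ⟨ν, rt * v, hν, mul_ne_zero hrt hv, ?_⟩
  rw [hrel]
  ring

end Summit.BirchSwinnertonDyer.BirchSwinnertonDyer.Theorems.OnePair

end
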